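import Summits.CriticalPhenomena.PercolationContinuityZ3.Theorems.PercNearOneGluingNoHeavyPcintChordDiagramDecomp
import Mathlib.GroupTheory.Perm.Cycle.Type
import HarnessLib

/-!
# CriticalPhenomena/PercolationContinuityZ3 — Theorems/PercNearOneGluingNoHeavyPcintChordDiagramCount.lean: the number of IRREDUCIBLE CHORD DIAGRAMS on `2n` points is the Touchard–Riordan number `connChord n` (combinatorial core of STRUCTURE law C5-L1, part 3)

Lane prim-pcint, STRUCTURE rule «numerics ⇒ structure ⇒ conjecture» (prim-pcint-2 GEN 20); sequel of …PcintChordDiagrams / …PcintChordDiagramDecomp.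
From the fibre count `card_goodSet_eq_sum` (`#Irr(α) = Σ_{R shape} #Irr((R ∪ {z})ᶜ)·#Irr(R ∪ {z})`) to the NUMBERS:
* `#Irr` is invariant under order isomorphism (`card_goodSet_congr`), so the parts count as `#Irr(Fin k)` (`card_goodSet_coe`);
* a chord diagram lives on an even number of points (`IsDiag.even_card`): `#Irr(Fin (2i+1)) = 0`; `#Irr(Fin 2) = 1`;
* the shapes of `Fin (M+3)` (bottom `0`, top `M+2`) are the blocks `{a, …, a+r−1}` with `1 ≤ a`, `a + r ≤ M + 1` (`shape_eq_blockOf`,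
  `isShape_blockOf`); there are `M + 1 − r` of size `r` (`card_shapeSet_filter_card`), whence `Σ_{R shape} F(|R|) = Σ_{r=1}^{M} (M+1−r)·F(r)`;
* the recurrence hidden in the tree's list definition of `connChord`: `a(n+1) = n·Σ_{k<n} a(k+1)·a(n−k)` (`connChord_succ`), and the symmetrisation
  `Σ_{k<m} (2k+1)·g(k) = m·Σ_{k<m} g(k)` for `g(m−1−k) = g(k)` (`sum_two_mul_add_one_of_symm`);
* **`card_goodSet_fin`: `#Irr(Fin 2n) = connChord n` for every `n ≥ 1`** (strong induction: the fibre count on `Fin 2n` reads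
  `Σ_{r=1}^{2n−3} (2n−2−r)·#Irr(Fin (2n−1−r))·#Irr(Fin (r+1))`; only odd `r = 2n−2k−1` survive, giving `Σ_{k=1}^{n−1} (2k−1)·a(k)·a(n−k) = (n−1)·Σ a(k)a(n−k) = a(n)`).
This is the classical theorem that connected (= irreducible) chord diagrams are counted by the Touchard–Riordan numbers (Touchard 1952; Riordan 1975;
Stein 1978; Nijenhuis–Wilf 1979; Flajolet–Noy 2000), here with "connected" in the block form needed by the self-avoiding-polygon application.

HONEST FRAMING: elementary finite combinatorics written for the proof of `polygonLeadingCoeffLaw` (all `m`, sequel …PcintPolygonChordWords).  No `sorry`;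
standard axioms.  Written by prim-pcint-2 gen 20 (prover-prim-pcint-2-g20-0), 2026-08-26.
-/

namespace Summit.CriticalPhenomena.PercolationContinuityZ3.Theorems.Pcint.ChordDiag

open Summit.CriticalPhenomena.PercolationContinuityZ3.Theorems.Pcint.MemoryTail (connChord connChordAux connChord_values)

variable {α β : Type*} [LinearOrder α] [Fintype α] [LinearOrder β] [Fintype β]

/-! ### Invariance under order isomorphism; parity; two points -/

/-- Conjugation of a self-map by an order isomorphism. [folklore] -/
def conj (e : α ≃o β) (π : α → α) : β → β := fun y => e (π (e.symm y))

/-- Irreducibility is transported by order isomorphisms. [folklore] -/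
theorem isGood_conj (e : α ≃o β) {π : α → α} (h : IsGood π) : IsGood (conj e π) := by
  classical
  refine ⟨fun y => ⟨?_, ?_⟩, fun I hIc hIcl => ?_⟩
  · simp only [conj, OrderIso.symm_apply_apply, (h.1 _).1, OrderIso.apply_symm_apply]
  · intro hy
    have := congrArg e.symm hy
    simp only [conj, OrderIso.symm_apply_apply] at this
    exact (h.1 _).2 this
  · set I' : Finset α := Finset.univ.filter fun a => e a ∈ I with hI'
    have memI' : ∀ {a : α}, a ∈ I' ↔ e a ∈ I := fun {a} => by simp [hI']
    have hc : Convex I' := fun x hx y hy t hxt hty =>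
      memI'.2 (hIc (memI'.1 hx) (memI'.1 hy) (e.monotone hxt) (e.monotone hty))
    have hcl : Closed π I' := fun t ht => by
      have := hIcl (memI'.1 ht)
      simp only [conj, OrderIso.symm_apply_apply] at this
      exact memI'.2 this
    rcases h.2 I' hc hcl with h0 | h1
    · left
      refine Finset.eq_empty_iff_forall_notMem.2 fun y hy => ?_
      have : e.symm y ∈ I' := memI'.2 (by simpa using hy)
      rw [h0] at this; exact Finset.notMem_empty _ this
    · right
      refine Finset.eq_univ_iff_forall.2 fun y => ?_
      have : e.symm y ∈ I' := Finset.eq_univ_iff_forall.1 h1 _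
      simpa using memI'.1 this

/-- **`#Irr` is an order-isomorphism invariant.** [folklore] -/
theorem card_goodSet_congr (e : α ≃o β) : (goodSet α).card = (goodSet β).card := by
  refine Finset.card_nbij' (conj e) (conj e.symm) ?_ ?_ ?_ ?_
  · intro π hπ; rw [Finset.mem_coe, mem_goodSet] at hπ ⊢; exact isGood_conj e hπ
  · intro σ hσ; rw [Finset.mem_coe, mem_goodSet] at hσ ⊢; exact isGood_conj e.symm hσ
  · intro π _; funext x; simp [conj]
  · intro σ _; funext y; simp [conj]

omit [Fintype α] in
/-- A part counts as `Fin` of its size. [folklore] -/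
theorem card_goodSet_coe (S : Finset α) : (goodSet ↥S).card = (goodSet (Fin S.card)).card :=
  (card_goodSet_congr (S.orderIsoOfFin rfl)).symm

/-- A chord diagram lives on an even number of points. [folklore] -/
theorem IsDiag.even_card {π : α → α} (h : IsDiag π) : Even (Fintype.card α) := by
  classical
  let σ : Equiv.Perm α := ⟨π, π, fun t => (h t).1, fun t => (h t).1⟩
  have hσ : σ ^ 2 = 1 := by
    ext t
    simp [sq, σ, (h t).1]
  have hsupp : σ.support = Finset.univ :=
    Finset.eq_univ_iff_forall.2 fun t => Equiv.Perm.mem_support.2 (h t).2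
  have := Equiv.Perm.two_dvd_card_support hσ
  rw [hsupp, Finset.card_univ] at this
  exact even_iff_two_dvd.2 this

/-- No irreducible (indeed no) chord diagram on an odd number of points. [folklore] -/
theorem card_goodSet_fin_odd (i : ℕ) : (goodSet (Fin (2 * i + 1))).card = 0 := by
  rw [Finset.card_eq_zero, Finset.eq_empty_iff_forall_notMem]
  intro π hπ
  have := (mem_goodSet.1 hπ).1.even_card
  rw [Fintype.card_fin] at this
  exact Nat.not_even_two_mul_add_one i this

/-- Exactly one (irreducible) chord diagram on two points. [folklore] -/
theorem card_goodSet_fin_two : (goodSet (Fin 2)).card = 1 := by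
  rw [Finset.card_eq_one]
  refine ⟨Fin.rev, Finset.ext fun π => ?_⟩
  rw [mem_goodSet, Finset.mem_singleton]
  have hdiag : ∀ σ : Fin 2 → Fin 2, IsDiag σ → σ = Fin.rev := by
    unfold IsDiag; decide
  have hgood : IsGood (Fin.rev : Fin 2 → Fin 2) := by
    refine ⟨by unfold IsDiag; decide, fun I _ hcl => ?_⟩
    have r0 : Fin.rev (0 : Fin 2) = 1 := by decide
    have r1 : Fin.rev (1 : Fin 2) = 0 := by decide
    by_cases h0 : (0 : Fin 2) ∈ I
    · right
      have h1 : (1 : Fin 2) ∈ I := by have := hcl h0; rwa [r0] at this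
      refine Finset.eq_univ_iff_forall.2 ?_
      rw [Fin.forall_fin_two]; exact ⟨h0, h1⟩
    · left
      have h1 : (1 : Fin 2) ∉ I := fun h => h0 (by have := hcl h; rwa [r1] at this)
      refine Finset.eq_empty_iff_forall_notMem.2 ?_
      rw [Fin.forall_fin_two]; exact ⟨h0, h1⟩
  exact ⟨fun h => hdiag π h.1, fun h => h ▸ hgood⟩

/-! ### The shapes of `Fin (M+3)` are the blocks `{a, …, a+r−1}`, `1 ≤ a`, `a + r ≤ M + 1` -/

/-- The block of `r` consecutive points of `Fin K` starting at `a`. [folklore] -/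
def blockOf (K a r : ℕ) : Finset (Fin K) := Finset.univ.filter fun t : Fin K => a ≤ (t : ℕ) ∧ (t : ℕ) < a + r

/-- Membership in a block. [folklore] -/
theorem mem_blockOf {K a r : ℕ} {t : Fin K} : t ∈ blockOf K a r ↔ a ≤ (t : ℕ) ∧ (t : ℕ) < a + r := by
  simp [blockOf]

/-- A block inside `Fin K` has `r` points. [folklore] -/
theorem card_blockOf {K a r : ℕ} (h : a + r ≤ K) : (blockOf K a r).card = r := by
  have hmap : (blockOf K a r).map Fin.valEmbedding = Finset.Ico a (a + r) := by
    ext m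
    simp only [Finset.mem_map, mem_blockOf, Fin.valEmbedding_apply, Finset.mem_Ico]
    constructor
    · rintro ⟨t, ⟨h1, h2⟩, rfl⟩; exact ⟨h1, h2⟩
    · rintro ⟨h1, h2⟩; exact ⟨⟨m, by omega⟩, ⟨h1, h2⟩, rfl⟩
  rw [← Finset.card_map Fin.valEmbedding, hmap, Nat.card_Ico]
  omega

/-- Blocks are convex. [folklore] -/
theorem convex_blockOf {K a r : ℕ} : Convex (blockOf K a r) := by
  intro x hx y hy t hxt hty
  rw [mem_blockOf] at hx hy ⊢
  have h1 := Fin.le_iff_val_le_val.1 hxt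
  have h2 := Fin.le_iff_val_le_val.1 hty
  omega

/-- The least point of a block. [folklore] -/
theorem min'_blockOf {K a r : ℕ} (hne : (blockOf K a r).Nonempty) : (((blockOf K a r).min' hne : Fin K) : ℕ) = a := by
  obtain ⟨h1, h2⟩ := mem_blockOf.1 (Finset.min'_mem _ hne)
  have hlt : a < K := lt_of_le_of_lt h1 (Fin.is_lt _)
  have hmem : (⟨a, hlt⟩ : Fin K) ∈ blockOf K a r := mem_blockOf.2 ⟨le_rfl, lt_of_le_of_lt h1 h2⟩
  have h3 : (((blockOf K a r).min' hne : Fin K) : ℕ) ≤ a := Finset.min'_le _ _ hmem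
  exact le_antisymm h3 h1

/-- **A non-empty convex set of `Fin K` is the block between its least and greatest points.** [folklore] -/
theorem Convex.eq_blockOf {K : ℕ} {I : Finset (Fin K)} (hc : Convex I) (hne : I.Nonempty) :
    I = blockOf K (I.min' hne) (((I.max' hne : Fin K) : ℕ) + 1 - I.min' hne) := by
  have hmm' := Fin.le_iff_val_le_val.1 (Finset.min'_le I _ (Finset.max'_mem I hne))
  ext t
  rw [mem_blockOf]
  constructor
  · intro ht
    have h1 := Fin.le_iff_val_le_val.1 (Finset.min'_le I t ht)
    have h2 := Fin.le_iff_val_le_val.1 (Finset.le_max' I t ht)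
    omega
  · rintro ⟨h1, h2⟩
    exact hc (Finset.min'_mem I hne) (Finset.max'_mem I hne) (Fin.le_iff_val_le_val.2 h1)
      (Fin.le_iff_val_le_val.2 (by omega))

/-- The size of a non-empty convex set of `Fin K`. [folklore] -/
theorem Convex.card_eq {K : ℕ} {I : Finset (Fin K)} (hc : Convex I) (hne : I.Nonempty) :
    I.card = ((I.max' hne : Fin K) : ℕ) + 1 - I.min' hne := by
  conv_lhs => rw [hc.eq_blockOf hne]
  exact card_blockOf (by have := (I.max' hne).2; omega)

/-- A shape of `Fin (M+3)` is the block from its least point, of admissible position and size. [folklore] -/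
theorem shape_eq_blockOf {M : ℕ} {R : Finset (Fin (M + 3))} (hR : IsShape (0 : Fin (M + 3)) (Fin.last (M + 2)) R) :
    ∃ a, 1 ≤ a ∧ a + R.card ≤ M + 1 ∧ R = blockOf (M + 3) a R.card ∧ ((R.min' hR.1 : Fin (M + 3)) : ℕ) = a := by
  obtain ⟨hne, hc, hzR, hbR, u, huR, huz, hu⟩ := hR
  have hmm' := Fin.le_iff_val_le_val.1 (Finset.min'_le R _ (Finset.max'_mem R hne))
  have hcard : R.card = ((R.max' hne : Fin (M + 3)) : ℕ) + 1 - R.min' hne := hc.card_eq hne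
  refine ⟨R.min' hne, ?_, ?_, by conv_lhs => rw [hc.eq_blockOf hne, ← hcard], rfl⟩
  · -- `0 ∉ R`
    by_contra h0
    push Not at h0
    have : R.min' hne = 0 := Fin.ext (by simpa using h0)
    exact hbR (this ▸ Finset.min'_mem R hne)
  · -- the point above `R`
    have h1v := Fin.lt_def.1 (hu _ (Finset.max'_mem R hne))
    have h2 : (u : ℕ) ≠ M + 2 := fun h => huz (Fin.ext (by simp [h]))
    have h3 := u.2
    rw [hcard]
    omega

/-- Conversely every admissible block is a shape of `Fin (M+3)`. [folklore] -/
theorem isShape_blockOf {M a r : ℕ} (ha : 1 ≤ a) (hr : 1 ≤ r) (h : a + r ≤ M + 1) :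
    IsShape (0 : Fin (M + 3)) (Fin.last (M + 2)) (blockOf (M + 3) a r) := by
  refine ⟨⟨⟨a, by omega⟩, mem_blockOf.2 ⟨le_rfl, by simp; omega⟩⟩, convex_blockOf, fun hz => ?_, fun hb => ?_,
    ⟨⟨a + r, by omega⟩, fun hu => ?_, fun hu => ?_, fun t ht => ?_⟩⟩
  · have := (mem_blockOf.1 hz).2; simp at this; omega
  · have := (mem_blockOf.1 hb).1; simp at this; omega
  · have := (mem_blockOf.1 hu).2; simp at this
  · have := congrArg Fin.val hu; simp at this; omega
  · exact Fin.lt_def.2 (by simpa using (mem_blockOf.1 ht).2)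

/-- **There are `M + 1 − r` shapes of size `r`** in `Fin (M+3)` (`1 ≤ r ≤ M`). [folklore] -/
theorem card_shapeSet_filter_card (M r : ℕ) (hr : 1 ≤ r) (hrM : r ≤ M) :
    ((shapeSet (0 : Fin (M + 3)) (Fin.last (M + 2))).filter fun R => R.card = r).card = M + 1 - r := by
  rw [show M + 1 - r = (Finset.Icc 1 (M + 1 - r)).card by simp]
  refine Finset.card_nbij' (fun R => if h : R.Nonempty then (((R.min' h : Fin (M + 3)) : ℕ)) else 0)
    (fun a => blockOf (M + 3) a r) ?_ ?_ ?_ ?_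
  · intro R hR
    rw [Finset.mem_coe, Finset.mem_filter, mem_shapeSet] at hR
    obtain ⟨hs, hcard⟩ := hR
    obtain ⟨a, ha1, haM, -, hmin⟩ := shape_eq_blockOf hs
    simp only [Finset.mem_coe, Finset.mem_Icc, dif_pos hs.1, hmin]
    omega
  · intro a ha
    rw [Finset.mem_coe, Finset.mem_Icc] at ha
    rw [Finset.mem_coe, Finset.mem_filter, mem_shapeSet]
    exact ⟨isShape_blockOf ha.1 hr (by omega), card_blockOf (by omega)⟩
  · intro R hR
    rw [Finset.mem_coe, Finset.mem_filter, mem_shapeSet] at hR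
    obtain ⟨hs, hcard⟩ := hR
    obtain ⟨a, -, -, hRa, hmin⟩ := shape_eq_blockOf hs
    simp only
    rw [dif_pos hs.1, hmin, ← hcard]
    exact hRa.symm
  · intro a ha
    rw [Finset.mem_coe, Finset.mem_Icc] at ha
    have hne : (blockOf (M + 3) a r).Nonempty := ⟨⟨a, by omega⟩, mem_blockOf.2 ⟨le_rfl, by simp; omega⟩⟩
    simp only
    rw [dif_pos hne]
    exact min'_blockOf hne

/-- **Summing a size function over the shapes of `Fin (M+3)`**: `Σ_{R} F(|R|) = Σ_{r=1}^{M} (M+1−r)·F(r)`. [folklore] -/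
theorem sum_shapeSet_fin (M : ℕ) (F : ℕ → ℕ) :
    ∑ R ∈ shapeSet (0 : Fin (M + 3)) (Fin.last (M + 2)), F R.card = ∑ r ∈ Finset.Icc 1 M, (M + 1 - r) * F r := by
  rw [← Finset.sum_fiberwise_of_maps_to (s := shapeSet (0 : Fin (M + 3)) (Fin.last (M + 2))) (t := Finset.Icc 1 M)
    (g := Finset.card) ?_]
  · refine Finset.sum_congr rfl fun r hr => ?_
    rw [Finset.mem_Icc] at hr
    rw [Finset.sum_congr rfl (g := fun _ => F r) (fun R hR => by rw [(Finset.mem_filter.1 hR).2]), Finset.sum_const,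
      smul_eq_mul, card_shapeSet_filter_card M r hr.1 hr.2]
  · intro R hR
    obtain ⟨a, ha1, haM, -, -⟩ := shape_eq_blockOf (mem_shapeSet.1 hR)
    rw [Finset.mem_Icc]
    exact ⟨Finset.card_pos.2 (mem_shapeSet.1 hR).1, by omega⟩

/-! ### The recurrence of `connChord` and its symmetrisation -/

/-- Length of the auxiliary list. [folklore] -/
theorem length_connChordAux (n : ℕ) : (connChordAux n).length = n := by
  induction n with
  | zero => rfl
  | succ n ih => simp [connChordAux, ih]

/-- The auxiliary list holds `a(1), …, a(n)`. [folklore] -/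
theorem getD_connChordAux {n k : ℕ} (hk : k < n) : (connChordAux n).getD k 0 = connChord (k + 1) := by
  induction n with
  | zero => omega
  | succ n ih =>
    rcases Nat.lt_succ_iff_lt_or_eq.1 hk with hk | rfl
    · rw [show connChordAux (n + 1) = connChordAux n ++ [_] from rfl,
        List.getD_append _ _ _ _ (by rw [length_connChordAux]; exact hk)]
      exact ih hk
    · rfl

/-- List sums over `List.range` are `Finset.range` sums. [folklore] -/
theorem sum_map_range (f : ℕ → ℕ) (n : ℕ) : ((List.range n).map f).sum = ∑ k ∈ Finset.range n, f k := by
  induction n with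
  | zero => simp
  | succ n ih => simp [List.range_succ, ih, Finset.sum_range_succ]

/-- **The Touchard–Riordan recurrence** as encoded by the tree's `connChord`: `a(n+1) = n·Σ_{k<n} a(k+1)·a(n−k)` (`n ≥ 1`). [folklore] -/
theorem connChord_succ {n : ℕ} (hn : 1 ≤ n) :
    connChord (n + 1) = n * ∑ k ∈ Finset.range n, connChord (k + 1) * connChord (n - k) := by
  have h1 : connChord (n + 1) = (connChordAux n ++ [if n = 0 then 1 else
      n * ((List.range n).map fun k => (connChordAux n).getD k 0 * (connChordAux n).getD (n - 1 - k) 0).sum]).getD n 0 := rfl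
  rw [h1, List.getD_eq_getElem?_getD, List.getElem?_append_right (by rw [length_connChordAux]), length_connChordAux,
    Nat.sub_self, List.getElem?_cons_zero, Option.getD_some, if_neg (by omega), sum_map_range]
  congr 1
  refine Finset.sum_congr rfl fun k hk => ?_
  rw [Finset.mem_range] at hk
  rw [getD_connChordAux hk, getD_connChordAux (by omega), show n - 1 - k + 1 = n - k by omega]

/-- Symmetrisation: `Σ_{k<m} (2k+1)·g(k) = m·Σ_{k<m} g(k)` when `g(m−1−k) = g(k)`. [folklore] -/
theorem sum_two_mul_add_one_of_symm (g : ℕ → ℕ) (m : ℕ) (hg : ∀ k < m, g (m - 1 - k) = g k) :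
    ∑ k ∈ Finset.range m, (2 * k + 1) * g k = m * ∑ k ∈ Finset.range m, g k := by
  have hA : ∑ k ∈ Finset.range m, k * g k = ∑ k ∈ Finset.range m, (m - 1 - k) * g k := by
    rw [← Finset.sum_range_reflect (fun k => k * g k) m]
    refine Finset.sum_congr rfl fun k hk => ?_
    rw [Finset.mem_range] at hk
    show (m - 1 - k) * g (m - 1 - k) = (m - 1 - k) * g k
    rw [hg k hk]
  calc ∑ k ∈ Finset.range m, (2 * k + 1) * g k
      = ∑ k ∈ Finset.range m, (k * g k + (k * g k + g k)) := Finset.sum_congr rfl fun k _ => by ring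
    _ = ∑ k ∈ Finset.range m, k * g k + (∑ k ∈ Finset.range m, (m - 1 - k) * g k + ∑ k ∈ Finset.range m, g k) := by
        rw [Finset.sum_add_distrib, Finset.sum_add_distrib, hA]
    _ = ∑ k ∈ Finset.range m, (k + (m - 1 - k) + 1) * g k := by
        rw [← Finset.sum_add_distrib, ← Finset.sum_add_distrib]
        exact Finset.sum_congr rfl fun k _ => by ring
    _ = ∑ k ∈ Finset.range m, m * g k := Finset.sum_congr rfl fun k hk => by
        rw [Finset.mem_range] at hk
        congr 1; omega
    _ = m * ∑ k ∈ Finset.range m, g k := by rw [Finset.mul_sum]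

/-! ### The count -/

/-- **The irreducible chord diagrams on `2n` points are counted by the Touchard–Riordan numbers**: `#Irr(Fin 2n) = connChord n` (`n ≥ 1`).
[folklore] -/
theorem card_goodSet_fin : ∀ n : ℕ, 1 ≤ n → (goodSet (Fin (2 * n))).card = connChord n := by
  intro n
  induction n using Nat.strong_induction_on with
  | _ n ih =>
  intro hn
  rcases Nat.lt_or_ge n 2 with hn2 | hn2
  · obtain rfl : n = 1 := by omega
    rw [connChord_values.1]
    exact card_goodSet_fin_two
  obtain ⟨M, hM⟩ : ∃ M, 2 * n = M + 3 := ⟨2 * n - 3, by omega⟩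
  rw [hM, card_goodSet_eq_sum (b := (0 : Fin (M + 3))) (z := Fin.last (M + 2)) (fun x => Fin.zero_le _)
    (fun x => Fin.le_last _) (by simp)]
  -- the parts count as `Fin` of their sizes
  have step : ∀ R ∈ shapeSet (0 : Fin (M + 3)) (Fin.last (M + 2)),
      (goodSet ↥((insert (Fin.last (M + 2)) R)ᶜ)).card * (goodSet ↥(insert (Fin.last (M + 2)) R)).card
        = (goodSet (Fin (M + 2 - R.card))).card * (goodSet (Fin (R.card + 1))).card := by
    intro R hR
    have hz : Fin.last (M + 2) ∉ R := (mem_shapeSet.1 hR).2.2.1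
    rw [card_goodSet_coe, card_goodSet_coe, Finset.card_compl, Finset.card_insert_of_notMem hz, Fintype.card_fin,
      show M + 3 - (R.card + 1) = M + 2 - R.card by omega]
  rw [Finset.sum_congr rfl step,
    sum_shapeSet_fin M (fun r => (goodSet (Fin (M + 2 - r))).card * (goodSet (Fin (r + 1))).card)]
  -- only the odd sizes `r = M − 2k` survive; reindex by `k < n − 1`
  have hodd : ∀ s : ℕ, s % 2 = 1 → (goodSet (Fin s)).card = 0 := by
    intro s hs
    obtain ⟨i, rfl⟩ : ∃ i, s = 2 * i + 1 := ⟨s / 2, by omega⟩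
    exact card_goodSet_fin_odd i
  rw [← Finset.sum_bij_ne_zero (s := Finset.range (n - 1)) (t := Finset.Icc 1 M)
    (f := fun k => (2 * k + 1) * ((goodSet (Fin (2 * (k + 1)))).card * (goodSet (Fin (2 * (n - 1 - k)))).card))
    (g := fun r => (M + 1 - r) * ((goodSet (Fin (M + 2 - r))).card * (goodSet (Fin (r + 1))).card))
    (fun k _ _ => M - 2 * k) ?_ ?_ ?_ ?_]
  rotate_left
  · intro k hk _
    rw [Finset.mem_range] at hk
    rw [Finset.mem_Icc]; omega
  · intro k₁ hk₁ _ k₂ hk₂ _ h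
    rw [Finset.mem_range] at hk₁ hk₂
    omega
  · intro r hr hne
    rw [Finset.mem_Icc] at hr
    have hr2 : r % 2 = 1 := by
      by_contra h
      exact hne (by rw [hodd (r + 1) (by omega), mul_zero, mul_zero])
    refine ⟨n - 2 - r / 2, Finset.mem_range.2 (by omega), ?_, by omega⟩
    have e1 : M - 2 * (n - 2 - r / 2) = r := by omega
    intro h0
    apply hne
    rw [← e1]
    rw [show 2 * (n - 2 - r / 2 + 1) = M + 2 - (M - 2 * (n - 2 - r / 2)) by omega,
      show 2 * (n - 1 - (n - 2 - r / 2)) = M - 2 * (n - 2 - r / 2) + 1 by omega,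
      show 2 * (n - 2 - r / 2) + 1 = M + 1 - (M - 2 * (n - 2 - r / 2)) by omega] at h0
    exact h0
  · intro k hk _
    rw [Finset.mem_range] at hk
    rw [show M + 1 - (M - 2 * k) = 2 * k + 1 by omega, show M + 2 - (M - 2 * k) = 2 * (k + 1) by omega,
      show M - 2 * k + 1 = 2 * (n - 1 - k) by omega]
  -- the induction hypothesis on both parts, then the recurrence
  have hih : ∀ k ∈ Finset.range (n - 1),
      (2 * k + 1) * ((goodSet (Fin (2 * (k + 1)))).card * (goodSet (Fin (2 * (n - 1 - k)))).card)
        = (2 * k + 1) * (connChord (k + 1) * connChord (n - 1 - k)) := by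
    intro k hk
    rw [Finset.mem_range] at hk
    rw [ih (k + 1) (by omega) (by omega), ih (n - 1 - k) (by omega) (by omega)]
  rw [Finset.sum_congr rfl hih, sum_two_mul_add_one_of_symm _ (n - 1) fun k hk => by
    rw [show n - 1 - 1 - k + 1 = n - 1 - k by omega, show n - 1 - (n - 1 - 1 - k) = k + 1 by omega, mul_comm]]
  conv_rhs => rw [show n = (n - 1) + 1 by omega]
  rw [connChord_succ (by omega)]

end Summit.CriticalPhenomena.PercolationContinuityZ3.Theorems.Pcint.ChordDiag
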